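import Summits.NavierStokesRegularity.TurbBounds.ShearSpecPieces
import HarnessLib

/-!
# The TWO-FIELD block rule of rbsdp SPEC §3.3–3.7 (plane Couette rows, family `couette_2p5d`; also the RB no-slip Legendre blocks) as computable rational tables

Cell `turb-bounds` (pub-turb), shear lane, pub-turb-shear gen 6 (2026-08-22); v2 lane (lead decision 92 (5)). Source of record: HOME/code/rbsdp/SPEC.md §3.3–3.7
(two-field Legendre-inner block, DK20/PK03 form) under the CERT-SHEAR §3 symbol map for plane Couette (RZG25 App. A): `M_m(c, ĝ, T) = c·Dc + Σ_p ĝ_p·G⁽ᵖ⁾ + T·CT`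
with `Dc = XW ⊕ XT`, `G⁽ᵖ⁾ = [E_p]_sym`, `CT = −ε(GW0 + HW) ⊕ −(GT0 + HT)/ε`, projected to `c_0 = c_1 = d_0 = 0` (pure index selection). The landed Couette evaluators
(`Certs/C200/EvalBlock<m>.eval_rule`: `B00m.A = den • (c·Dc + Σ ĝ_p G⁽ᵖ⁾ + T·CT)`) take these pieces as literal data; this file DEFINES them from the SPEC text, generic in
`(N, P)` with the per-mode rational data `(KINV2, K2, ε)`, so that `Certs/C200/SpecPieces<m>*.lean` can check `densify dim X_js X_vs = <rule>` by `decide +kernel`.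
Contents (lists over `ℚ`, reusing `ShearSpecPieces`' toolbox `norm2`/`triple`/`intEntry`/`intRow`/`axpy`/`gramAdd`/…):
* §3.4 tail weights `omega J j` and `lamAdj J = λ(J, J+1)`; §3.3 ladders `tfD1` (`LW−1` rows), `tfD0` (`LW−2` rows), `tfDT` (`LT−1` rows), `LW = N+P+3`, `LT = N+P+2`;
* §3.5/3.7 `xwTab` (`16·KINV2·diag w + 8ΣwD1ᵀD1 + K2ΣwD0ᵀD0`), `xtTab` (`4·diag w + K2ΣwDTᵀDT`), `tfKTab`/`tfETab` (`E_p = D0ᵀK_pDT` on `S = {(n ≤ N ∨ m' ≤ N), n ≤ LW−3, m' ≤ LT−2}`);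
* §3.6 `gt0Tab`, `htDiag`, `gw0Tab`, `hwTab` (`Σ_{j<LW−1} ω_{LW−2}(j)D1[j]ᵀD1[j] + μ_W·diag ω_{LW−1}`, `μ_W = lamAdj (LW−2)`), `tfLamW = μ_W·lamAdj(LW−1)`, `tfLamT = lamAdj(LT−1)`;
* the three piece families `dcPiece N P KINV2 K2`, `gPiece N P p`, `ctPiece N P ε` (projected `dim × dim` row lists, `dim = (LW−2)+(LT−1)`).
Nothing analytic is proved here; kernel tests at the bottom. Python twin: lean-t12/specpieces/proto_tf.py (reproduces generator A's R-C200 dump, 22/22 modes, all pieces + λ_W/λ_T).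
HONEST FRAMING: rigorous bounds for the stated PDE and boundary conditions; no claim about physical turbulence beyond the bound.
-/

set_option linter.style.longLine false

namespace Summit.NavierStokesRegularity.TurbBounds.ShearSpecPiecesTF

open Summit.NavierStokesRegularity.TurbBounds.ShearSpecPieces

/-! ### §3.4 tail weights -/

/-- SPEC 3.4: `ω_J(j) = 4/((2j+1)²(2j+3))·[j ≥ J−1] + 4/((2j−1)(2j+1)²)·[j ≥ J+1]`. -/
def omega (J j : ℕ) : ℚ :=
  (if J ≤ j + 1 then 4 / ((2 * (j : ℚ) + 1) ^ 2 * (2 * (j : ℚ) + 3)) else 0)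
    + (if J + 1 ≤ j then 4 / ((2 * (j : ℚ) - 1) * (2 * (j : ℚ) + 1) ^ 2) else 0)

/-- SPEC 3.4: `λ(J, J+1) = ω_J(J+1)·(2J+3)/2` (the case `Jv = J+1`, the only one the rows use). -/
def lamAdj (J : ℕ) : ℚ := omega J (J + 1) * ((2 * ((J : ℚ) + 1) + 1) / 2)

/-! ### §3.3 ladders -/

/-- `D1 = integrate_rows(LW, LW−1)` (`W_x` from `W_xx`, `W_x(−1) = 0`): `LW−1` dense rows of length `LW = N+P+3`. -/
def tfD1 (N P : ℕ) : List (List ℚ) := (List.range (N + P + 2)).map (intRow (N + P + 3))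

/-- `D0 = integrate_rows(LW−1, LW−2) ∘ D1` (`W` from `W_x`, `W(−1) = 0`): `LW−2` rows. -/
def tfD0 (N P : ℕ) : List (List ℚ) :=
  (List.range (N + P + 1)).map fun n =>
    (((List.range (N + P + 2)).zip (tfD1 N P)).filter fun ir => intEntry n ir.1 ≠ 0).foldl
      (fun acc ir => axpy (intEntry n ir.1) ir.2 acc) (zeroVec (N + P + 3))

/-- `DT = integrate_rows(LT, LT−1)` (`Θ` from `Θ_x`, `Θ(−1) = 0`): `LT−1` rows of length `LT = N+P+2`. -/
def tfDT (N P : ℕ) : List (List ℚ) := (List.range (N + P + 1)).map (intRow (N + P + 2))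

/-- `G + Σ_{n<len} w(n) • rows[n] rows[n]ᵀ` for a weight function. -/
def gramSum (wt : ℕ → ℚ) (rows : List (List ℚ)) (G : List (List ℚ)) : List (List ℚ) :=
  ((List.range rows.length).zip rows).foldl (fun acc nr => gramAdd (wt nr.1) nr.2 acc) G

/-! ### §3.5 / §3.7 positive parts -/

/-- `XW = 16·KINV2·diag(w) + 8·Σ_{n<LW−1} w_n D1[n]ᵀD1[n] + K2·Σ_{n<LW−2} w_n D0[n]ᵀD0[n]` (`LW × LW`). -/
def xwTab (N P : ℕ) (KINV2 K2 : ℚ) : List (List ℚ) :=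
  let LW := N + P + 3
  gramSum (fun n => K2 * norm2 n) (tfD0 N P)
    (gramSum (fun n => 8 * norm2 n) (tfD1 N P) (diagMat ((List.range LW).map fun j => 16 * KINV2 * norm2 j)))

/-- `XT = 4·diag(w) + K2·Σ_{n<LT−1} w_n DT[n]ᵀDT[n]` (`LT × LT`). -/
def xtTab (N P : ℕ) (K2 : ℚ) : List (List ℚ) :=
  let LT := N + P + 2
  gramSum (fun n => K2 * norm2 n) (tfDT N P) (diagMat ((List.range LT).map fun j => 4 * norm2 j))

/-! ### §3.5 coupling -/

/-- `K_p[n][m'] = Λ(n, m', p)` on `S = {(n ≤ N ∨ m' ≤ N)}`, rows `n < LW−2`, columns `m' < LT−1`. -/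
def tfKTab (N P p : ℕ) : List (List ℚ) :=
  (List.range (N + P + 1)).map fun n => (List.range (N + P + 1)).map fun m' =>
    if n ≤ N ∨ m' ≤ N then triple n m' p else 0

/-- `E_p = D0ᵀ K_p DT` (`LW × LT`): first `K_p DT` row by row, then `Σ_n D0[n] ⊗ (K_p DT)[n]`. -/
def tfETab (N P p : ℕ) : List (List ℚ) :=
  let LW := N + P + 3
  let LT := N + P + 2
  let dt := tfDT N P
  let kdt := (tfKTab N P p).map fun krow => ((krow.zip dt).filter fun cv => cv.1 ≠ 0).foldl (fun acc cv => axpy cv.1 cv.2 acc) (zeroVec LT)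
  ((tfD0 N P).zip kdt).foldl (fun G xr => outerAdd xr.1 xr.2 G) (zeroMat LW LT)

/-! ### §3.6 tails -/

/-- `GT0 = Σ_{n=N+1}^{LT−2} w_n DT[n]ᵀDT[n]` (`LT × LT`). -/
def gt0Tab (N P : ℕ) : List (List ℚ) :=
  let LT := N + P + 2
  gramSum (fun n => if N + 1 ≤ n then norm2 n else 0) (tfDT N P) (zeroMat LT LT)

/-- `HT = diag(ω_{LT−1}(j))_{j<LT}`. -/
def htDiag (N P : ℕ) : List ℚ := (List.range (N + P + 2)).map fun j => omega (N + P + 1) j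

/-- `GW0 = Σ_{n=N+1}^{LW−3} w_n D0[n]ᵀD0[n]` (`LW × LW`). -/
def gw0Tab (N P : ℕ) : List (List ℚ) :=
  let LW := N + P + 3
  gramSum (fun n => if N + 1 ≤ n then norm2 n else 0) (tfD0 N P) (zeroMat LW LW)

/-- `μ_W = λ(LW−2, LW−1)`. -/
def tfMuW (N P : ℕ) : ℚ := lamAdj (N + P + 1)

/-- `HW = Σ_{j<LW−1} ω_{LW−2}(j) D1[j]ᵀD1[j] + μ_W·diag(ω_{LW−1}(j))_{j<LW}`. -/
def hwTab (N P : ℕ) : List (List ℚ) :=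
  let LW := N + P + 3
  gramSum (fun j => omega (N + P + 1) j) (tfD1 N P) (diagMat ((List.range LW).map fun j => tfMuW N P * omega (N + P + 2) j))

/-- `λ_W = μ_W·λ(LW−1, LW)`. -/
def tfLamW (N P : ℕ) : ℚ := tfMuW N P * lamAdj (N + P + 2)

/-- `λ_T = λ(LT−1, LT)`. -/
def tfLamT (N P : ℕ) : ℚ := lamAdj (N + P + 1)

/-! ### §3.7 pieces, projected to `c_0 = c_1 = d_0 = 0` -/

/-- The kept full indices: `2 … LW−1` (c-part) then `LW+1 … LW+LT−1` (d-part), written as shifted ranges (`LW = N+P+3`, `LT = N+P+2`). -/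
def keepIdx (N P : ℕ) : List ℕ :=
  ((List.range (N + P + 1)).map fun i => i + 2) ++ ((List.range (N + P + 1)).map fun j => j + (N + P + 4))

/-- Tabulate a full-index entry function on `keep × keep`. -/
def selectTab (N P : ℕ) (Mf : ℕ → ℕ → ℚ) : List (List ℚ) := (keepIdx N P).map fun i => (keepIdx N P).map fun j => Mf i j

/-- `A ⊕ B` as an entry function (`A : LW × LW`, `B : LT × LT`). -/
def blockDiag (LW : ℕ) (A B : List (List ℚ)) (r s : ℕ) : ℚ :=
  if r < LW ∧ s < LW then get2 A r s else if LW ≤ r ∧ LW ≤ s then get2 B (r - LW) (s - LW) else 0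

/-- `[E]_sym`: off-diagonal blocks `E` (`LW × LT`) and `Eᵀ`, as an entry function. -/
def offSym (LW : ℕ) (E : List (List ℚ)) (r s : ℕ) : ℚ :=
  if r < LW ∧ LW ≤ s then get2 E r (s - LW) else if LW ≤ r ∧ s < LW then get2 E s (r - LW) else 0

/-- **Piece `Dc`** `= (XW ⊕ XT)` projected. -/
def dcPiece (N P : ℕ) (KINV2 K2 : ℚ) : List (List ℚ) := selectTab N P (blockDiag (N + P + 3) (xwTab N P KINV2 K2) (xtTab N P K2))

/-- **Piece `G⁽ᵖ⁾`** `= [E_p]_sym` projected. -/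
def gPiece (N P p : ℕ) : List (List ℚ) := selectTab N P (offSym (N + P + 3) (tfETab N P p))

/-- **Piece `CT`** `= (−ε(GW0 + HW)) ⊕ (−(GT0 + HT)/ε)` projected (`ε` = the mode's Young weight, rational DATA). -/
def ctPiece (N P : ℕ) (eps : ℚ) : List (List ℚ) :=
  selectTab N P (blockDiag (N + P + 3) (matScale (-eps) (matAdd (gw0Tab N P) (hwTab N P)))
    (matScale (-1 / eps) (matAdd (gt0Tab N P) (diagMat (htDiag N P)))))

/-! ### kernel tests -/

/-- R-C200's recorded tail constants at `(N, P) = (8, 12)`: `λ_T = 4/2021`, `λ_W = 16/4456305` (container G1-couette2p5d-Re200-P12-N16, mode 1). -/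
example : tfLamT 8 12 = 4 / 2021 ∧ tfLamW 8 12 = 16 / 4456305 := by decide +kernel

/-- `dim = (LW−2) + (LT−1) = 42` at `(8, 12)`. -/
example : (keepIdx 8 12).length = 42 := by decide +kernel

end Summit.NavierStokesRegularity.TurbBounds.ShearSpecPiecesTF
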